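/-
Copyright (c) 2026 the pub-hodgecm-mathlib formalisation cell (harness21).  Prover seat hodgecm-mathlib-F0P3a-p01 (g37), FLOOR 0, SUPPORTS-ONLY on h413; dealer∕pen
LH4-plan (g13) WORD #117 «THE (β) TABLE'S DEFS∕TRUNK∕IDENTITY TRIPLE, SUCCESSOR-DESIGNATE» (T1) under LH4-p05 (g8)'s B2b-3 ARCHITECTURE OF RECORD 13:57:18Z.  2026-09-04.
-/
import Mathlib.Algebra.BigOperators.Fin
import Mathlib.Data.Rat.Defs
import HarnessLib

/-!
# Crux `H413`, LH4 «(D-RAM) FOUR-FRAME» road, STAGE 1b (β) — DEFS LEAF «(T-box | odd)»: the LABELLED-ODD BOX SUM of the clean-shell Stage-B table as ONE named arithmetic Prop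
# `OddLabelledBoxSum` — **v1 DRAFT BY PATH (not filed): ★ rows VERBATIM, the capped tube rows beyond the one-slot cell as PROPOSED binders, and ONE rest-sum row `hrest`
# carrying ALL the open mathematics (κ-classes, glue classes, core-hanging strata) with its explicit target**

Cell `hodgecm-mathlib` (D-0151), crux item H413 = `stmt-HodgeConjecture-24833`, route of record `HCCMUnconditional`.  DEFINITION LEAF (one `def … : Prop`, no theorem, no instance,
no notation, no `sorry`); lane `--kind definition --supports stmt-HodgeConjecture-24833 --as helper` (count-neutral: it PAYS NO tier-0 row).  Twin of ★ p860066
`F0P3cDyRamLevLabelledBoxSumDefs.LevLabelledBoxSum` (F0P3a-p01 (g36)) for the (β) road: the consumer is LH4-p05 (g8)'s ★ p860646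
`F0P3cDyRamLabelledOddStageBBoxForm.dyadicFence_cleanSgnFrameConstLawAt_derived_ofRecord_of_box (hbox)`, whose `hbox` the TRUNK (T2) `…LabelledOddStageBTable.hbox_of_oddBoxSum`
derives from this Prop stratum by stratum, and whose proof (T3) `…OddLabelledBoxSum.oddLabelledBoxSum` (LH4-p08 (g9), WORD #118) is pure finite-sum bookkeeping over `ℚ`.

WHAT IT SAYS.  Letters (LEAN convention): `(n₁, n₂, n₃) = (v(β−1), v(α−1), v(α−β))` (isosceles, parities `nᵢ ≡ d (mod 2)`, derived regime `n0DerivedOfRecord d = 3d − 2 + d%2 ≤ nᵢ`),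
`q = #𝓀`, `ℓ₀ = d % 2`, `m* = d % 2 + 2d − 1` (`mstarOfRecord d`, spelt out); the four sign tokens `ωA = ω(e_A)`, `ωB = ω(e_B)`, `ωC = ω(e_C)` (tower-sign tokens of `α−1`, `β−1`, `β−α`,
★ p860771∕p860907) and `ωm = ω(−1)` as integers of square `1`; `v a` = the per-stratum table `Σᶠ_{M ∈ stratum σ ϖ T a, clean shell} labelledOddCount σ ϖ 0 i Λ M ∕ [𝒰 : N S̃′(M)]`.
ROWS (one binder each; ★ = a theorem's right-hand side VERBATIM with `Fintype.card 𝓀[K] ↦ q`, `normSign σ e_X ↦ ωX`; box = `Fin 3 → Fin (n₁+n₂+n₃+1)` as in `hbox`):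
* `hcore` (P1): `v ![0,0,0] = 0` (the normalised core is off the shell in the derived regime) — F0P3a-p01 (g37).
* `hT1 ∕ hT2 ∕ hT3`: the towers `![0,s,s] ∕ ![s,0,s] ∕ ![s,s,0]` — ★ p860780 (LH4-p11 (g8)) ∕ ★ p860897, with their token-free zeros ★ p860805.
* `hG1 ∕ hG2`: the glued strata `![2ρ,2ρ+s,2ρ+s] ∕ ![2ρ+s,2ρ,2ρ+s]` IN THE ONE-SLOT CELL `2ρ + m* ≤ n₂` resp. `≤ n₁` — ★ p860827 ∕ ★ p860856 (LH4-p11 (g8)), zeros included.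
* `hG1b ∕ hG2b` (P3, PROPOSED — ODDBOX-ORACLE v1 bdcd88096e7908a6 §1, 0 mismatches on all 10 keys of F0P3-p01's strata tables): BEYOND the cell (`n₂ < 2ρ + m*` resp. `n₁ < …`),
  the CAPPED TUBE classes `2ρ + s + ℓ₀ = n_X`, `2 ∣ s`, `2ρ + 2 + ℓ₀ ≤ min(other depths)` carry `ωX∕2 · q^{2ρ+s∕2−1} · F(n_{j+1} − ℓ₀ − 2ρ)` in each non-own slot `j` (times `ωm` on
  the twisted slot), `F(D) = (q−1) ∣ −1 (D = 2d−2) ∣ 0`, written `(if 2d + ℓ₀ + 2ρ ≤ n then q − 1 else 0) − (if n + 2 = 2d + ℓ₀ + 2ρ then 1 else 0)` — the PER-SLOT twist depth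
  (LH4-p11 SIG-PureCells §1∕§4's boundary values «−1∕(q−1)» ∕ «0», own slot `0`); owners LH4-p13 (g8) ★ p860847 × LH4-p14 (g6) B3.  `hG3t` (P2+P3, PROPOSED): ALL capped tube classes
  of tower 3 `![2ρ+s,2ρ+s,2ρ]` (token `ωC`, twisted slot `0`) in the same currency (no ★ cell column exists yet; LH4-p11 may split it cell ∕ beyond — then (T2) assembles).
* `hrest` (P4+P5): **ONE ROW FOR ALL THE REST** — the sum of `v` over the rest shapes `IsRestShape d n₁ n₂ n₃` (core-hanging `![2ρ,2ρ,2ρ]`, ρ ≥ 1, and every glued stratum that is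
  NOT a capped tube class: the special tower's off-shell class `2ρ = m − ℓ₀, s = s_g`, its κ-classes `2ρ = m − ℓ₀, s < s_g`, the glue classes `2ρ > m`, and all unread strata) EQUALS
  `restTarget q d n₁ n₂ n₃ ωA ωB ωC ωm i = −[i is the special slot ∧ s_g ≥ 2d − 2] · (σ_Y[i] + σ_Z[i])∕2 · q^{m − ℓ₀ − 1}` (Y, Z the two non-special towers; `0` at equilateral keys) —
  EXACTLY minus what the tower rows leave in the special slot when the two non-special towers end in the pure range (ODDBOX §3).  This is where the open mathematics of the table lives
  (at q = 2 it is the κ-class `G_{X*}(m−ℓ₀, 2)` alone — 10∕10 keys; for q ≥ 4 the core-hanging stratum `2ρ = m − ℓ₀` on the clean shell, (q−2)q^{2ρ−1} orbits ★, must share it);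
  owners LH4-p13 (g8) × LH4-p14 (g6) × (H) TBD — ONE lattice statement, provable by any class decomposition they like.
* `hzero`: off the ★ B3 shape list `v a = 0` (★ `finsum_stratum_sep_eq_zero_of_not_shape`).
NO SIGN RELATIONS are hypotheses: the identity holds for ARBITRARY `ωA ωB ωC ωm ∈ ℚ`-values of the letters (it is multilinear bookkeeping); the token relations of the field
(`ω(e_C) = ω(−1)ω(e_A)` when `s_g ≥ 2d`, …) only decide which classes realise `restTarget`, i.e. they live inside the proof of `hrest`, not here.
NUMERICAL CERTIFICATE of THIS statement (not a proof): `F0/P3a/F0P3a-p01/g37/oddbox/t1v1.py` — (i) the tower ∕ tube rows reproduce the observed per-stratum E-vectors at all 10 keys of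
F0P3-p01's strata tables and the observed rest classes sum to `8 · restTarget` at every key (0 mismatches); (ii) `Σ(tube rows) + restTarget = 0` on 22 680 (q ∈ {2,3,4,9}, d = 2..6,
isosceles key in the derived regime with s_g ≤ 12, sign values incl. non-units, slot) instances, 0 non-zero.
HONEST LABEL: a named arithmetic Prop (route-internal bookkeeping identity, NOT a published result); v1 = DRAFT whose (P2)(P3) rows and the `hrest` cut are PROPOSALS; count-neutral; (β)∕table OPEN;
HC_CM is proved only modulo the 7 printed citations (2 remaining named inputs: hLiu418 = `stmt-HodgeConjecture-24832`, h413 = `stmt-HodgeConjecture-24833`) until rung 0 closes.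

## References
* [Kottwitz1986BaseChangeUnits] R. E. Kottwitz, *Base change for unit elements of Hecke algebras*, Compositio Math. 60 (1986), §1 pp. 240–241 (signed lattice counts by torus orbits).
* [Rogawski1990] J. D. Rogawski, *Automorphic Representations of Unitary Groups in Three Variables*, Ann. of Math. Stud. 123 (1990), §4.9 Prop. 4.9.1 (a)(b) p. 55; §4.10 p. 58.
* [LanglandsShelstad1987] R. P. Langlands, D. Shelstad, *On the definition of transfer factors*, Math. Ann. 278 (1987), §1.3, §3.
-/

set_option autoImplicit false

namespace Summit.HodgeConjecture.HodgeConjecture.Cruxes.H413.F0P3cDyRamOddLabelledBoxSumDefs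

open Finset

/-- The REST SHAPES of the box: the core-hanging axis vectors `![2ρ,2ρ,2ρ]` (`ρ ≥ 1`) and the glued axis vectors (own slot `2ρ ≥ 2` even, the other two equal `2ρ + s`, `s ≥ 1`,
`2 ∣ s`) that are NOT capped tube classes of their tower (`2ρ + s + ℓ₀ = n_X ∧ 2ρ + 2 + ℓ₀ ≤ min(other two depths)`).  Decidable arithmetic on the entries. -/
abbrev IsRestShape (d n₁ n₂ n₃ : ℕ) (a : Fin 3 → ℕ) : Prop :=
  (a 0 = a 1 ∧ a 1 = a 2 ∧ 2 ≤ a 0 ∧ 2 ∣ a 0) ∨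
  (a 1 = a 2 ∧ a 0 < a 1 ∧ 2 ≤ a 0 ∧ 2 ∣ a 0 ∧ 2 ∣ a 1 ∧ ¬ (a 1 + d % 2 = n₁ ∧ a 0 + 2 + d % 2 ≤ min n₂ n₃)) ∨
  (a 0 = a 2 ∧ a 1 < a 0 ∧ 2 ≤ a 1 ∧ 2 ∣ a 1 ∧ 2 ∣ a 0 ∧ ¬ (a 0 + d % 2 = n₂ ∧ a 1 + 2 + d % 2 ≤ min n₁ n₃)) ∨
  (a 0 = a 1 ∧ a 2 < a 0 ∧ 2 ≤ a 2 ∧ 2 ∣ a 2 ∧ 2 ∣ a 0 ∧ ¬ (a 0 + d % 2 = n₃ ∧ a 2 + 2 + d % 2 ≤ min n₁ n₂))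

/-- The REST TARGET per slot: minus the residual the two non-special towers leave in the special slot when they end in the pure range (`s_g ≥ 2d − 2`), `0` otherwise
(in particular at equilateral keys): slot `0` special (`n₂ = n₃ < n₁`): `−(ωA + ωm·ωC)∕2 · q^{n₂−ℓ₀−1}`; slot `1` special: `−(ωB + ωC)∕2 · q^{n₁−ℓ₀−1}`; slot `2` special:
`−(ωm·ωB + ωm·ωA)∕2 · q^{n₁−ℓ₀−1}`. -/
def restTarget (q d n₁ n₂ n₃ : ℕ) (ωA ωB ωC ωm : ℤ) (i : Fin 3) : ℚ :=
  (![if n₂ = n₃ ∧ n₂ + 2 * d ≤ n₁ + 2 then -((ωA : ℚ) + ωm * ωC) / 2 * (q : ℚ) ^ (n₂ - d % 2 - 1) else 0,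
     if n₁ = n₃ ∧ n₁ + 2 * d ≤ n₂ + 2 then -((ωB : ℚ) + ωC) / 2 * (q : ℚ) ^ (n₁ - d % 2 - 1) else 0,
     if n₁ = n₂ ∧ n₁ + 2 * d ≤ n₃ + 2 then -((ωm : ℚ) * ωB + ωm * ωA) / 2 * (q : ℚ) ^ (n₁ - d % 2 - 1) else 0] : Fin 3 → ℚ) i

/-- **`OddLabelledBoxSum` — THE LABELLED-ODD BOX SUM OF THE CLEAN-SHELL STAGE-B TABLE VANISHES (brick (T-box | odd), an arithmetic Prop).**  For every residue cardinality `q`,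
wild depth `d ≥ 2`, isosceles element depths `(n₁, n₂, n₃)` in the derived regime with the parities of `d`, slot `i`, sign letters `ωA ωB ωC ωm`, and every table `v` on axis
vectors whose rows are the tower rows (★ verbatim), the capped tube rows (★ cell + PROPOSED beyond), the rest-sum row `hrest` and `0` off the shape list:
`Σ_{a : Fin 3 → Fin (n₁+n₂+n₃+1)} v a = 0`.  Pure finite-sum bookkeeping over `ℚ` (no lattices, no sign relations). -/
def OddLabelledBoxSum : Prop :=
  ∀ (q : ℕ) {d n₁ n₂ n₃ : ℕ} (_hd : 2 ≤ d)
    (_hiso : (n₁ = n₂ ∧ n₁ ≤ n₃) ∨ (n₁ = n₃ ∧ n₁ ≤ n₂) ∨ (n₂ = n₃ ∧ n₂ ≤ n₁))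
    (_hreg : 3 * d - 2 + d % 2 ≤ n₁ ∧ 3 * d - 2 + d % 2 ≤ n₂ ∧ 3 * d - 2 + d % 2 ≤ n₃)
    (_h1 : n₁ % 2 = d % 2) (_h2 : n₂ % 2 = d % 2) (_h3 : n₃ % 2 = d % 2)
    (i : Fin 3) (ωA ωB ωC ωm : ℤ)
    (v : (Fin 3 → ℕ) → ℚ) (_hcore : v ![0, 0, 0] = 0)
    (_hT1 : ∀ s, 1 ≤ s → v ![0, s, s] =
      if s + d % 2 = n₁ ∧ 2 ∣ s then ((if i = 1 then ωB else if i = 2 then ωm * ωB else 0 : ℤ) : ℚ) / 2 * (q : ℚ) ^ (s / 2) else 0)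
    (_hT2 : ∀ s, 1 ≤ s → v ![s, 0, s] =
      if s + d % 2 = n₂ ∧ 2 ∣ s then ((if i = 0 then ωA else if i = 2 then ωm * ωA else 0 : ℤ) : ℚ) / 2 * (q : ℚ) ^ (s / 2) else 0)
    (_hT3 : ∀ s, 1 ≤ s → v ![s, s, 0] =
      if s + d % 2 = n₃ ∧ 2 ∣ s then ((if i = 0 then ωm * ωC else if i = 1 then ωC else 0 : ℤ) : ℚ) / 2 * (q : ℚ) ^ (s / 2) else 0)
    (_hG1 : ∀ ρ s, 1 ≤ ρ → 1 ≤ s → 2 * ρ + (d % 2 + 2 * d - 1) ≤ n₂ → v ![2 * ρ, 2 * ρ + s, 2 * ρ + s] =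
      if 2 * ρ + s + d % 2 = n₁ ∧ 2 ∣ s ∧ 2 * ρ ≤ min n₂ n₃ then
        (ωB : ℚ) / 2 *
          (![(0 : ℚ), ((q : ℚ) - 1) * (q : ℚ) ^ (2 * ρ + s / 2 - 1),
              (ωm : ℚ) * (q : ℚ) ^ (2 * ρ + s / 2 - 1) * ((if 2 * d ≤ s then (q : ℚ) - 1 else 0) - (if s + 2 = 2 * d then 1 else 0))] : Fin 3 → ℚ) i
      else 0)
    (_hG2 : ∀ ρ s, 1 ≤ ρ → 1 ≤ s → 2 * ρ + (d % 2 + 2 * d - 1) ≤ n₁ → v ![2 * ρ + s, 2 * ρ, 2 * ρ + s] =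
      if 2 * ρ + s + d % 2 = n₂ ∧ 2 ∣ s ∧ 2 * ρ ≤ min n₁ n₃ then
        (ωA : ℚ) / 2 *
          (![((q : ℚ) - 1) * (q : ℚ) ^ (2 * ρ + s / 2 - 1), (0 : ℚ),
              (ωm : ℚ) * (q : ℚ) ^ (2 * ρ + s / 2 - 1) * ((if 2 * d ≤ s then (q : ℚ) - 1 else 0) - (if s + 2 = 2 * d then 1 else 0))] : Fin 3 → ℚ) i
      else 0)
    (_hG1b : ∀ ρ s, 1 ≤ ρ → n₂ < 2 * ρ + (d % 2 + 2 * d - 1) → 2 * ρ + s + d % 2 = n₁ → 2 ∣ s → 2 * ρ + 2 + d % 2 ≤ min n₂ n₃ →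
      v ![2 * ρ, 2 * ρ + s, 2 * ρ + s] = (ωB : ℚ) / 2 * (q : ℚ) ^ (2 * ρ + s / 2 - 1) *
        (![(0 : ℚ),
            (if 2 * d + d % 2 + 2 * ρ ≤ n₂ then (q : ℚ) - 1 else 0) - (if n₂ + 2 = 2 * d + d % 2 + 2 * ρ then 1 else 0),
            (ωm : ℚ) * ((if 2 * d + d % 2 + 2 * ρ ≤ n₃ then (q : ℚ) - 1 else 0) - (if n₃ + 2 = 2 * d + d % 2 + 2 * ρ then 1 else 0))] : Fin 3 → ℚ) i)
    (_hG2b : ∀ ρ s, 1 ≤ ρ → n₁ < 2 * ρ + (d % 2 + 2 * d - 1) → 2 * ρ + s + d % 2 = n₂ → 2 ∣ s → 2 * ρ + 2 + d % 2 ≤ min n₁ n₃ →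
      v ![2 * ρ + s, 2 * ρ, 2 * ρ + s] = (ωA : ℚ) / 2 * (q : ℚ) ^ (2 * ρ + s / 2 - 1) *
        (![(if 2 * d + d % 2 + 2 * ρ ≤ n₁ then (q : ℚ) - 1 else 0) - (if n₁ + 2 = 2 * d + d % 2 + 2 * ρ then 1 else 0),
            (0 : ℚ),
            (ωm : ℚ) * ((if 2 * d + d % 2 + 2 * ρ ≤ n₃ then (q : ℚ) - 1 else 0) - (if n₃ + 2 = 2 * d + d % 2 + 2 * ρ then 1 else 0))] : Fin 3 → ℚ) i)
    (_hG3t : ∀ ρ s, 1 ≤ ρ → 2 * ρ + s + d % 2 = n₃ → 2 ∣ s → 2 * ρ + 2 + d % 2 ≤ min n₁ n₂ →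
      v ![2 * ρ + s, 2 * ρ + s, 2 * ρ] = (ωC : ℚ) / 2 * (q : ℚ) ^ (2 * ρ + s / 2 - 1) *
        (![(ωm : ℚ) * ((if 2 * d + d % 2 + 2 * ρ ≤ n₁ then (q : ℚ) - 1 else 0) - (if n₁ + 2 = 2 * d + d % 2 + 2 * ρ then 1 else 0)),
            (if 2 * d + d % 2 + 2 * ρ ≤ n₂ then (q : ℚ) - 1 else 0) - (if n₂ + 2 = 2 * d + d % 2 + 2 * ρ then 1 else 0),
            (0 : ℚ)] : Fin 3 → ℚ) i)
    (_hrest : ∑ a : Fin 3 → Fin (n₁ + n₂ + n₃ + 1),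
        (if IsRestShape d n₁ n₂ n₃ (fun j => (a j : ℕ)) then v (fun j => (a j : ℕ)) else 0) = restTarget q d n₁ n₂ n₃ ωA ωB ωC ωm i)
    (_hzero : ∀ a : Fin 3 → ℕ, ¬ ((a = ![0, 0, 0]) ∨
      (∃ s, 2 ∣ s ∧ 2 ≤ s ∧ (a = ![0, s, s] ∨ a = ![s, 0, s] ∨ a = ![s, s, 0])) ∨
      (∃ ρ s, 1 ≤ ρ ∧ 2 ∣ s ∧ 2 ≤ s ∧ (a = ![2 * ρ, 2 * ρ + s, 2 * ρ + s] ∨ a = ![2 * ρ + s, 2 * ρ, 2 * ρ + s] ∨ a = ![2 * ρ + s, 2 * ρ + s, 2 * ρ])) ∨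
      (∃ ρ, 1 ≤ ρ ∧ a = ![2 * ρ, 2 * ρ, 2 * ρ])) → v a = 0),
    ∑ a : Fin 3 → Fin (n₁ + n₂ + n₃ + 1), v (fun j => (a j : ℕ)) = 0

end Summit.HodgeConjecture.HodgeConjecture.Cruxes.H413.F0P3cDyRamOddLabelledBoxSumDefs
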